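import Mathlib
import Summits.ValiantsHypothesis.ValiantsHypothesis.Theses.FreeSubtorus
import Summits.ValiantsHypothesis.ValiantsHypothesis.Theorems.FreeSubtorusSubtorusCovering
import Summits.ValiantsHypothesis.ValiantsHypothesis.Cruxes.OrbitDimensionBound.Lines.ConfusionLadder
import Summits.ValiantsHypothesis.ValiantsHypothesis.Theorems.DetqpThesis.Negative.IffPerNotVQP
import Literature.Computability.AlgebraicComplexity.HamiltonianCycleVNP
import Literature.Computability.AlgebraicComplexity.ValiantConjectureEquivProofs
import Literature.Computability.AlgebraicComplexity.StandardFamiliesProofs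
import Literature.Computability.AlgebraicComplexity.PBoundedGrowth
import Literature.Computability.AlgebraicComplexity.DetInVP
import Literature.Computability.AlgebraicComplexity.EquivariantDC

/-!
# `PiecewiseLadder` — forward rung g4 on the crux `FreeSubtorus.OrbitDimensionBound`

FORWARD GENERATOR G1 (next-rung), unit `fwd2-rung-ValiantsHypothesis-01-g4`.

* FLOOR (proved, `Theorems/FreeSubtorusSubtorusCovering.lean`):
  `SubtorusCovering` — for `n ≥ 3`, every exactly `T_Λ`-equivariant affine determinantal representation `B` of
  `per_n` of size `m` (`Λ` admissible with `r` generators) has `C(n,⌊n/2⌋) ≤ m · 2^r`.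
* THE ONE MOVE (hypothesis H3 `det B = per_n` generalised; direction of the summit = LESS symmetry):
  replace the single equivariant representation by a PIECEWISE-EQUIVARIANT DECOMPOSITION
  `per_n = P₁ + ⋯ + P_k`, each piece `P_i = det B_i` carrying its OWN exactly `T_Λ`-equivariant affine
  representation `B_i` of size `m`.  The sum is `T_Λ`-invariant, the pieces need not be: symmetry is demanded
  only piece by piece ("a sum of `k` symmetric determinants", the equivariant analogue of IMM/ABP width or of
  rank-`k` / read-`k` determinantal expressions).
* FAMILY `SumCovering K` (at most `K` pieces): `C(n,⌊n/2⌋) ≤ k · m · 2^r` for every such decomposition with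
  `k ≤ K` pieces.  `SumCovering 1 ↔ SubtorusCovering` (the floor; `k = 0` is vacuous since `per_n ≠ 0`);
  the dial is antitone (`K ≤ K' → SumCovering K' → SumCovering K`); the numeric RUNG is
  `PiecewiseCovering := ∀ k, PieceCovering k` (all `K`).  Far end `k = n!`, `m = n`, `r = 0` (one monomial per
  piece, each a diagonal — fully equivariant — matrix) meets the bound with room; the free end (no symmetry at
  all on a single piece) is NOT a member: the ladder interpolates symmetry → none through the number of pieces.
* RUNG DECLARATION for the kernel: the asymptotic shadow `PieceShadow` (along any sequence of piecewise-
  equivariant decompositions of `per_n`, `n ↦ k_n · m_n · 2^{r_n}` is not p-bounded).  ON-PATH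
  `ValiantsHypothesis → PieceShadow` is PROVED here (`pieceShadow_of_summit`: a p-bounded sequence gives
  circuits for `per_n` of size `k·(L(det_m) + m²(2n²+1)) + k`, hence `VP = VNP`).  REAL STEP: the floor's
  proof uses `det B = per_n` twice (vzG/LR regularity `corank B(x₀) ≤ 1` at every point of the hypersurface, and
  the count of "served" permutations `coeff_σ det B = 1`); for a piece `det B_i = P_i ≠ per_n` both are gone —
  irregular pieces (`corank B_i(0) = c ≥ 2`, e.g. Hadamard–Pólya pieces `det (M ∘ X)` of size `n`) exist and
  their anchored path families are `c`-tuples of vertex-disjoint paths (Lindström–Gessel–Viennot), and only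
  `∑_i coeff_σ P_i = 1` survives.  The new input the rung asks for is a SIGNED (Pólya–Gibson–Brualdi type)
  covering count for sums.
* RELAXED SYMMETRISATION TARGET `OrbitPieceBound`: an optimal representation of `per_n` may be replaced by a
  piecewise-equivariant decomposition with pieces of the same size, spending the symmetry budget `2^{⌊n/2⌋}`
  on torus corank OR on pieces (`k · 2^r ≤ 2^{⌊n/2⌋}`); `closes_piecewise : OrbitPieceBound → PiecewiseCovering →
  ValiantsHypothesis` (via `Confusion.vh_of_middle_bound`), and `OrbitDimensionBound → OrbitPieceBound`.

References: [LandsbergRessayre2017] Thm. 2.8, Question 2.2, §6; [IkenmeyerLandsberg2017] (arXiv:1610.00159)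
Def. 2.8 / Thm. 2.9 / Rem. 2.10 (rank-`k` and read-`k` determinantal expressions; Aravind–Joglekar 2015,
Anderson–Shpilka–Volk); Brualdi–Ryser, *Combinatorial Matrix Theory* (1991) §7 p. 201 (Pólya's problem,
Gibson 1971: no sign conversion of `per_n` to `det` for `n ≥ 3`... beyond affine maps; Marcus–Minc 1961);
[Vonzurgathen1987] Thm. 3.1; Bürgisser 2000 Def. 2.1–2.2, Rem. 2.11 (`PER ∈ VP ↔ VP = VNP`).
-/

set_option linter.dupNamespace false
set_option linter.unusedVariables false

namespace Summit.ValiantsHypothesis.ValiantsHypothesis.Cruxes.OrbitDimensionBound.Piecewise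

open Literature.Computability.AlgebraicComplexity
open Summit.ValiantsHypothesis.ValiantsHypothesis.Cruxes.OrbitDimensionBound.Confusion
  (Loss CoveringShadow powLoss vh_of_middle_bound)

noncomputable section

/-! ## §1 Vocabulary: the admissible subtorus, piecewise-equivariant decompositions -/

/-- The subtorus `T_Λ ≤ GL_{n²}(ℂ)` cut out of `{diag(d_k e_l)}` by the characters `Λ` (the floor's set-builder,
named). [cite: LandsbergRessayre2017, §6] -/
def subtorus (n r : ℕ) (Λ : Fin r → (Fin n ⊕ Fin n) → ℤ) :
    Subgroup (Matrix.GeneralLinearGroup (Fin n × Fin n) ℂ) :=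
  Subgroup.closure {γ : Matrix.GeneralLinearGroup (Fin n × Fin n) ℂ |
    ∃ d e : Fin n → ℂˣ, (∀ i, (∏ k, (d k) ^ (Λ i (Sum.inl k))) * (∏ l, (e l) ^ (Λ i (Sum.inr l))) = 1) ∧
      (γ : Matrix (Fin n × Fin n) (Fin n × Fin n) ℂ) = Matrix.diagonal (fun p => (d p.1 : ℂ) * (e p.2 : ℂ))}

/-- Admissibility of `Λ` (zero row- and column-weight sums: `T_Λ ⊇` the `per`-stabilising torus `T'`).
[cite: LandsbergRessayre2017, §6] -/
def Admissible (n r : ℕ) (Λ : Fin r → (Fin n ⊕ Fin n) → ℤ) : Prop :=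
  ∀ i, (∑ k, Λ i (Sum.inl k)) = 0 ∧ (∑ l, Λ i (Sum.inr l)) = 0

/-- **Piecewise-equivariant decomposition** of `per_n` with `k` pieces of size `m` for the torus `T_Λ`:
`per_n = ∑_i P_i` and each `B_i` is an exactly `T_Λ`-equivariant affine determinantal representation of its
piece `P_i` (`IsEquivariantDetRepr`: affine entries, `det B_i = P_i`, constant lifts `(g, h) ∈ GL_m(ℂ)²` for every
`γ ∈ T_Λ`).  THE NEW OBJECT of this rung. [cite: IkenmeyerLandsberg2017, Def. 2.8] -/
def IsPiecewiseRepr (n k m r : ℕ) (Λ : Fin r → (Fin n ⊕ Fin n) → ℤ)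
    (P : Fin k → MvPolynomial (Fin n × Fin n) ℂ)
    (B : Fin k → Matrix (Fin m) (Fin m) (MvPolynomial (Fin n × Fin n) ℂ)) : Prop :=
  (∑ i, P i) = perPoly (Fin n) ℂ ∧ ∀ i, IsEquivariantDetRepr (subtorus n r Λ) (P i) (B i)

/-! ## §2 The family `SumCovering K`, the floor `K = 1`, the numeric rung `PiecewiseCovering` -/

/-- Family member "exactly `k` pieces": `C(n,⌊n/2⌋) ≤ k · m · 2^r`. [conjecture piece of this line] -/
def PieceCovering (k : ℕ) : Prop :=
  ∀ n : ℕ, 3 ≤ n → ∀ (m r : ℕ) (Λ : Fin r → (Fin n ⊕ Fin n) → ℤ)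
    (P : Fin k → MvPolynomial (Fin n × Fin n) ℂ)
    (B : Fin k → Matrix (Fin m) (Fin m) (MvPolynomial (Fin n × Fin n) ℂ)),
    Admissible n r Λ → IsPiecewiseRepr n k m r Λ P B → Nat.choose n (n / 2) ≤ k * m * 2 ^ r

/-- **The dial** `SumCovering K`: at most `K` pieces. `K = 1` is the floor, `K → ∞` the rung. -/
def SumCovering (K : ℕ) : Prop := ∀ k, k ≤ K → PieceCovering k

/-- **The numeric rung** `PiecewiseCovering`: any number of pieces. -/
def PiecewiseCovering : Prop := ∀ k, PieceCovering k

/-- The dial is antitone: more pieces allowed ⇒ stronger statement. [folklore] -/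
theorem SumCovering.anti {K K' : ℕ} (hKK' : K ≤ K') (h : SumCovering K') : SumCovering K :=
  fun k hk => h k (hk.trans hKK')

/-- The rung is the top of the dial. [folklore] -/
theorem piecewiseCovering_iff : PiecewiseCovering ↔ ∀ K, SumCovering K :=
  ⟨fun h K k _ => h k, fun h k => h k k le_rfl⟩

/-- `per_n` has total degree `n`. [cite: Burgisser2000, §2.1] -/
theorem totalDegree_perPoly (n : ℕ) : (perPoly (Fin n) ℂ).totalDegree = n := by
  simpa using (perPoly_isHomogeneous (n := Fin n) (k := ℂ)).totalDegree (perPoly_ne_zero (Fin n) ℂ)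

/-- A piecewise decomposition of `per_n` (`n ≥ 1`) has at least one piece. [folklore] -/
theorem one_le_pieces {n k m r : ℕ} (hn : 1 ≤ n) {Λ : Fin r → (Fin n ⊕ Fin n) → ℤ}
    {P : Fin k → MvPolynomial (Fin n × Fin n) ℂ}
    {B : Fin k → Matrix (Fin m) (Fin m) (MvPolynomial (Fin n × Fin n) ℂ)}
    (h : IsPiecewiseRepr n k m r Λ P B) : 1 ≤ k := by
  rcases Nat.eq_zero_or_pos k with rfl | hk
  · exfalso
    have hsum := h.1
    simp only [Finset.univ_eq_empty, Finset.sum_empty] at hsum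
    exact perPoly_ne_zero (Fin n) ℂ hsum.symm
  · exact hk

/-- A piecewise decomposition of `per_n` (`n ≥ 1`) has pieces of size `≥ 1` (size-`0` pieces are the constant
`1`, and `per_n` is not a constant). [folklore] -/
theorem one_le_size {n k m r : ℕ} (hn : 1 ≤ n) {Λ : Fin r → (Fin n ⊕ Fin n) → ℤ}
    {P : Fin k → MvPolynomial (Fin n × Fin n) ℂ}
    {B : Fin k → Matrix (Fin m) (Fin m) (MvPolynomial (Fin n × Fin n) ℂ)}
    (h : IsPiecewiseRepr n k m r Λ P B) : 1 ≤ m := by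
  rcases Nat.eq_zero_or_pos m with rfl | hm
  · exfalso
    obtain ⟨hsum, hB⟩ := h
    have hP : ∀ i, P i = 1 := fun i => by
      have := (hB i).1.2
      rw [Matrix.det_isEmpty] at this
      exact this.symm
    have hconst : perPoly (Fin n) ℂ = MvPolynomial.C (k : ℂ) := by
      rw [← hsum]
      simp [hP]
    have hdeg := totalDegree_perPoly n
    rw [hconst, MvPolynomial.totalDegree_C] at hdeg
    omega
  · exact hm

/-- `k = 0` pieces: vacuous (`per_n ≠ 0`). [folklore] -/
theorem pieceCovering_zero : PieceCovering 0 := by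
  intro n hn m r Λ P B hΛ h
  have := one_le_pieces (by omega) h
  omega

/-- **`K = 1` is the floor**: one piece `P₀ = per_n` is exactly an equivariant representation of `per_n`.
[cite: LandsbergRessayre2017, Thm. 2.8] -/
theorem pieceCovering_one_iff :
    PieceCovering 1 ↔ Summit.ValiantsHypothesis.ValiantsHypothesis.Theses.FreeSubtorus.SubtorusCovering := by
  constructor
  · intro h n hn m r Λ B hΛ hB
    have := h n hn m r Λ (fun _ => perPoly (Fin n) ℂ) (fun _ => B) hΛ ⟨by simp, fun _ => hB⟩
    simpa using this
  · intro h n hn m r Λ P B hΛ hPB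
    obtain ⟨hsum, hB⟩ := hPB
    have hP : P 0 = perPoly (Fin n) ℂ := by simpa using hsum
    have := h n hn m r Λ (B 0) hΛ (hP ▸ hB 0)
    simpa using this

/-- `SumCovering 1 ↔ SubtorusCovering`. [cite: LandsbergRessayre2017, Thm. 2.8] -/
theorem sumCovering_one_iff :
    SumCovering 1 ↔ Summit.ValiantsHypothesis.ValiantsHypothesis.Theses.FreeSubtorus.SubtorusCovering := by
  constructor
  · exact fun h => pieceCovering_one_iff.1 (h 1 le_rfl)
  · intro h k hk
    interval_cases k
    · exact pieceCovering_zero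
    · exact pieceCovering_one_iff.2 h

/-- **The floor is a member of the family**: `SumCovering 1` holds (tree theorem `subtorusCovering_proof`).
[cite: LandsbergRessayre2017, Thm. 2.8] -/
theorem sumCovering_one : SumCovering 1 :=
  sumCovering_one_iff.2
    Summit.ValiantsHypothesis.ValiantsHypothesis.Theorems.FreeSubtorusSubtorusCovering.subtorusCovering_proof

/-- rung ⇒ floor. [folklore] -/
theorem subtorusCovering_of_piecewiseCovering (h : PiecewiseCovering) :
    Summit.ValiantsHypothesis.ValiantsHypothesis.Theses.FreeSubtorus.SubtorusCovering :=
  pieceCovering_one_iff.1 (h 1)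

/-! ## §3 The asymptotic shadow `PieceShadow` (the RUNG DECLARATION) and ON-PATH `S → PieceShadow` -/

/-- **`PieceShadow`** — the rung's asymptotic shadow, comparable with the (asymptotic) summit: along ANY sequence
of piecewise-equivariant decompositions of `per_n` (`k_n` pieces of size `m_n`, torus `T_{Λ_n}` with `r_n`
admissible generators), `n ↦ k_n · m_n · 2^{r_n}` is not p-bounded. -/
def PieceShadow : Prop :=
  ∀ (k m r : ℕ → ℕ) (Λ : (n : ℕ) → Fin (r n) → (Fin n ⊕ Fin n) → ℤ)
    (P : (n : ℕ) → Fin (k n) → MvPolynomial (Fin n × Fin n) ℂ)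
    (B : (n : ℕ) → Fin (k n) → Matrix (Fin (m n)) (Fin (m n)) (MvPolynomial (Fin n × Fin n) ℂ)),
    (∀ n : ℕ, 3 ≤ n → Admissible n (r n) (Λ n) ∧ IsPiecewiseRepr n (k n) (m n) (r n) (Λ n) (P n) (B n)) →
    ¬ IsPBounded (fun n => k n * m n * 2 ^ (r n))

/-- numeric rung ⇒ shadow (the middle binomial is not p-bounded, tree `not_isPBounded_choose_middle`).
[folklore] -/
theorem pieceShadow_of_piecewiseCovering (h : PiecewiseCovering) : PieceShadow := by
  intro k m r Λ P B hyp hPB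
  exact not_isPBounded_choose_middle
    (IsPBounded.of_eventually_le 3 hPB fun n hn => h (k n) n hn (m n) (r n) (Λ n) (P n) (B n)
      (hyp n hn).1 (hyp n hn).2)

/-- The shadow of the rung implies the shadow of the floor (one piece). [folklore] -/
theorem coveringShadow_of_pieceShadow (h : PieceShadow) : CoveringShadow powLoss := by
  intro m r Λ B hyp hPB
  refine h (fun _ => 1) m r Λ (fun n _ => perPoly (Fin n) ℂ) (fun n _ => B n)
    (fun n hn => ⟨(hyp n hn).1, by simp, fun _ => (hyp n hn).2⟩) ?_
  refine hPB.mono fun n => ?_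
  simp [powLoss]

/-- Circuit size of a piecewise decomposition: `L(per_n) ≤ k · (8(m+1)^7 + m²(2n²+1)) + k`
(Berkowitz circuit for `det_m`, substitution of affine entries, `k - 1` additions).
[cite: BurgisserClausenShokrollahi1997, (21.4)] -/
theorem complexity_perPoly_le_of_isPiecewiseRepr {n k m r : ℕ} {Λ : Fin r → (Fin n ⊕ Fin n) → ℤ}
    {P : Fin k → MvPolynomial (Fin n × Fin n) ℂ}
    {B : Fin k → Matrix (Fin m) (Fin m) (MvPolynomial (Fin n × Fin n) ℂ)}
    (h : IsPiecewiseRepr n k m r Λ P B) :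
    complexity (perPoly (Fin n) ℂ) ≤ k * (8 * (m + 1) ^ 7 + m ^ 2 * (2 * (n * n) + 1)) + k := by
  obtain ⟨hsum, hB⟩ := h
  rw [← hsum]
  have := complexity_sum_le_of_le Finset.univ P (8 * (m + 1) ^ 7 + m ^ 2 * (2 * (n * n) + 1))
    (fun i _ => (Summit.ValiantsHypothesis.Theorems.DetqpThesis.Negative.complexity_le_of_isAffineDetRepr
      (hB i).1).trans (by
        have := complexity_detPoly_le ℂ m
        simp only [Fintype.card_prod, Fintype.card_fin]
        omega))
  simpa using this

/-- **ON-PATH `S → PieceShadow`** (proved): a p-bounded sequence of piecewise-equivariant decompositions gives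
p-bounded circuits for `(per_n)`, i.e. `PER` is p-computable, i.e. `VP_ℂ = VNP_ℂ` (Bürgisser 2000 Rem. 2.11,
tree `isPComputable_perPoly_complex_iff`). Tagged `aesop safe apply` so the tribunal kernel's `intro h; aesop`
closes `S → PieceShadow`. [cite: Burgisser2000, Rem. 2.11] -/
@[aesop safe apply]
theorem pieceShadow_of_summit (hS : _root_.ValiantsHypothesis) : PieceShadow := by
  intro k m r Λ P B hyp hPB
  -- abbreviation for the p-bounded quantity
  set t : ℕ → ℕ := fun n => k n * m n * 2 ^ (r n) with ht_def
  have hk : ∀ n, 3 ≤ n → k n ≤ t n := fun n hn => by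
    have h1 := one_le_size (by omega) (hyp n hn).2
    have h2 : 1 ≤ 2 ^ (r n) := Nat.one_le_two_pow
    calc k n = k n * 1 * 1 := by ring
      _ ≤ k n * m n * 2 ^ (r n) := by gcongr
  have hm : ∀ n, 3 ≤ n → m n ≤ t n := fun n hn => by
    have h1 := one_le_pieces (by omega) (hyp n hn).2
    have h2 : 1 ≤ 2 ^ (r n) := Nat.one_le_two_pow
    calc m n = 1 * m n * 1 := by ring
      _ ≤ k n * m n * 2 ^ (r n) := by gcongr
  -- the bounding function, p-bounded
  let F : ℕ → ℕ := fun n => t n * (8 * (t n + 1) ^ 7 + t n ^ 2 * (2 * (n * n) + 1)) + t n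
  have hF : IsPBounded F := by
    have ht : IsPBounded t := hPB
    have h1 : IsPBounded fun n => t n + 1 := IsPBounded.add_holds ht (IsPBounded.const 1)
    have h2 : IsPBounded fun n => (t n + 1) ^ 7 := IsPBounded.pow_holds h1 7
    have h3 : IsPBounded fun n => 8 * (t n + 1) ^ 7 := IsPBounded.mul_holds (IsPBounded.const 8) h2
    have h4 : IsPBounded fun n => t n ^ 2 := IsPBounded.pow_holds ht 2
    have h5 : IsPBounded fun n => 2 * (n * n) + 1 :=
      IsPBounded.add_holds (IsPBounded.mul_holds (IsPBounded.const 2)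
        (IsPBounded.mul_holds IsPBounded.id IsPBounded.id)) (IsPBounded.const 1)
    have h6 : IsPBounded fun n => t n ^ 2 * (2 * (n * n) + 1) := IsPBounded.mul_holds h4 h5
    have h7 : IsPBounded fun n => 8 * (t n + 1) ^ 7 + t n ^ 2 * (2 * (n * n) + 1) :=
      IsPBounded.add_holds h3 h6
    exact IsPBounded.add_holds (IsPBounded.mul_holds ht h7) ht
  -- complexity of per_n is eventually ≤ F
  have hL : IsPComputable (fun n => perPoly (Fin n) ℂ) := by
    refine IsPBounded.of_eventually_le 3 hF fun n hn => ?_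
    refine (complexity_perPoly_le_of_isPiecewiseRepr (hyp n hn).2).trans ?_
    have hkn := hk n hn
    have hmn := hm n hn
    show k n * (8 * (m n + 1) ^ 7 + m n ^ 2 * (2 * (n * n) + 1)) + k n ≤
      t n * (8 * (t n + 1) ^ 7 + t n ^ 2 * (2 * (n * n) + 1)) + t n
    gcongr
  have hEq : VP ℂ = VNP ℂ := isPComputable_perPoly_complex_iff.1 hL
  exact hS hEq

/-- For the record: `S → shadow of the floor` through the rung. [folklore] -/
theorem powShadow_of_summit' (hS : _root_.ValiantsHypothesis) : CoveringShadow powLoss :=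
  coveringShadow_of_pieceShadow (pieceShadow_of_summit hS)

/-! ## §4 How the rung relaxes the open crux `OrbitDimensionBound` -/

/-- **`OrbitPieceBound`** — the symmetrisation target RELAXED by the rung: for `n ≥ 3`, every affine determinantal
representation `A` of `per_n` of size `m` can be replaced by a PIECEWISE-`T_Λ`-equivariant decomposition of `per_n`
with pieces of the same size `m`, for some admissible `Λ`, the symmetry budget `2^{⌊n/2⌋}` being spent on torus
corank or on the number of pieces: `k · 2^r ≤ 2^{⌊n/2⌋}`.  `OrbitDimensionBound` is the case `k = 1`.
[cite: LandsbergRessayre2017, Question 2.2] -/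
def OrbitPieceBound : Prop :=
  ∀ n : ℕ, 3 ≤ n → ∀ (m : ℕ) (A : Matrix (Fin m) (Fin m) (MvPolynomial (Fin n × Fin n) ℂ)),
    IsAffineDetRepr (perPoly (Fin n) ℂ) A →
    ∃ (k r : ℕ) (Λ : Fin r → (Fin n ⊕ Fin n) → ℤ) (P : Fin k → MvPolynomial (Fin n × Fin n) ℂ)
      (B : Fin k → Matrix (Fin m) (Fin m) (MvPolynomial (Fin n × Fin n) ℂ)),
      k * 2 ^ r ≤ 2 ^ (n / 2) ∧ Admissible n r Λ ∧ IsPiecewiseRepr n k m r Λ P B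

/-- `OrbitDimensionBound → OrbitPieceBound` (one piece). [folklore] -/
theorem orbitPieceBound_of_orbitDimensionBound
    (h : Summit.ValiantsHypothesis.ValiantsHypothesis.Theses.FreeSubtorus.OrbitDimensionBound) :
    OrbitPieceBound := by
  intro n hn m A hA
  obtain ⟨B, r, Λ, hr, hΛ, hB⟩ := h n hn m A hA
  refine ⟨1, r, Λ, fun _ => perPoly (Fin n) ℂ, fun _ => B, ?_, hΛ, by simp, fun _ => hB⟩
  simpa using Nat.pow_le_pow_right (by norm_num : 0 < 2) hr

/-- **`closes_piecewise : OrbitPieceBound → PiecewiseCovering → ValiantsHypothesis`** — the relaxed target plus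
the rung decide the summit (`C(n,⌊n/2⌋) ≤ k · dc(per_n) · 2^r ≤ dc(per_n) · 2^{⌊n/2⌋}`, then
`Confusion.vh_of_middle_bound`). [cite: BurgisserClausenShokrollahi1997, Cor. (21.40)] -/
theorem closes_piecewise (h₁ : OrbitPieceBound) (h₂ : PiecewiseCovering) : _root_.ValiantsHypothesis := by
  refine vh_of_middle_bound fun n hn => ?_
  obtain ⟨A, hA⟩ := hasDetRepr_determinantalComplexity_holds (perPoly (Fin n) ℂ)
  obtain ⟨k, r, Λ, P, B, hk, hΛ, hPB⟩ := h₁ n hn _ A hA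
  calc Nat.choose n (n / 2) ≤ k * determinantalComplexity (perPoly (Fin n) ℂ) * 2 ^ r :=
        h₂ k n hn _ r Λ P B hΛ hPB
    _ = determinantalComplexity (perPoly (Fin n) ℂ) * (k * 2 ^ r) := by ring
    _ ≤ determinantalComplexity (perPoly (Fin n) ℂ) * 2 ^ (n / 2) := Nat.mul_le_mul_left _ hk

/-- `closes_rung : OrbitDimensionBound → PiecewiseCovering → ValiantsHypothesis` (rung ⇒ floor ⇒ host `closes`).
[cite: LandsbergRessayre2017, Thm. 2.8] -/
theorem closes_rung (h₁ : Summit.ValiantsHypothesis.ValiantsHypothesis.Theses.FreeSubtorus.OrbitDimensionBound)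
    (h₂ : PiecewiseCovering) : _root_.ValiantsHypothesis :=
  Summit.ValiantsHypothesis.ValiantsHypothesis.Theses.FreeSubtorus.closes h₁
    (subtorusCovering_of_piecewiseCovering h₂)

end

end Summit.ValiantsHypothesis.ValiantsHypothesis.Cruxes.OrbitDimensionBound.Piecewise
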